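import Literature.Geometry.Lorentzian.AsymptoticFlatnessEnergy
import Literature.Geometry.Lorentzian.ADMFrameIndependence
import Literature.Geometry.Lorentzian.TameGenericity
import Literature.MeasureTheory.Hausdorff.SphereArea
import HarnessLib

/-!
# The ADM energy fluxes are Lipschitz in the weighted `C¹` distance of the end

For two initial data sets `D`, `D'` read in the chart of the SAME asymptotically flat end `e`,
the ADM energy fluxes `E(r) = (16π)⁻¹ ∮_{S_r} ∑ᵢⱼ (∂ⱼhᵢⱼ − ∂ᵢhⱼⱼ) xⁱ/r dσ`
(`AFEnd.admEnergyFlux`) through every coordinate sphere `r > R` satisfy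

  `|E_D(r) − E_{D'}(r)| ≤ (9/2) · sup_{‖x‖ > R} ‖x‖² ‖D(h − h')(x)‖`

(`AFEnd.abs_admEnergyFlux_sub_le`): the flux integrands differ by the normal component of the
ADM field `admVecOf b (D(h − h')(x))`, of norm `≤ 18 ‖D(h − h')(x)‖ ≤ 18 W / r²`
(`AFEnd.abs_fluxIntegrand_sub_le`), integrated over a sphere of area `4πr²` and divided by `16π`.
In particular the order-one term of the Dafermos–Rodnianski weighted distance `e.wDist D D'`
controls all far fluxes uniformly in `r` (`AFEnd.abs_admEnergyFlux_sub_le_of_wDist_le`), and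
along a TAME family (`InitialDataSet.IsTameDataFamily`: `e.wDist (F c) (F 0) → 0`) the fluxes
through ALL far spheres are uniformly close to those of the base datum for small parameters
(`InitialDataSet.IsTameDataFamily.admEnergyFlux_uniform`) — the quantitative form of "no screening
mass can be parked anywhere in the tail of a tame family" (first lemma `TameFluxControl` of the
crux-B idea card `causal-quarantine`, `Summits/FinalStateConjecture/…/Cruxes/TameExitsLocalise`).
This is the linear part of Bartnik's flux estimate (CPAM 39 (1986), §4, (4.2), Prop. 4.1) read
for a difference of metrics; everything is proved, no definitions, no named facts.

## References

* R. Bartnik, *The mass of an asymptotically flat manifold*, CPAM 39 (1986), §4, (4.2), Prop. 4.1.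
* M. Dafermos, I. Rodnianski, *Lectures on black holes and linear waves*, arXiv:0811.0354,
  App. B.2.3 (the weighted class).
* D. Christodoulou, CQG 16 (1999) A23, p. A24 (the fixed space `𝓐` of data with fixed
  asymptotics).
-/

noncomputable section

-- instance search on the nested operator spaces of metric components and their derivatives
-- (`E3 →L[ℝ] E3 →L[ℝ] E3 →L[ℝ] ℝ`) is deep and slow on `E3` (as in `AsymptoticFlatnessEnergy`)
set_option maxSynthPendingDepth 3
set_option synthInstance.maxHeartbeats 200000

open Manifold Bundle TopologicalSpace Filter Metric MeasureTheory Set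
open scoped ContDiff Topology ENNReal RealInnerProductSpace

namespace Literature.Geometry.Lorentzian

open Literature.MeasureTheory.Hausdorff

namespace AFEnd

variable {X : Type*} [TopologicalSpace X] [ChartedSpace E3 X] [IsManifold (𝓡 3) ∞ X]
  (e : AFEnd X)

/-! ### Pointwise: the flux integrands differ by the normal component of the ADM field of `h − h'` -/

/-- The ADM flux integrand `∑ᵢⱼ (∂ⱼhᵢⱼ − ∂ᵢhⱼⱼ)(x) xⁱ/r` is continuous on the open chart region
`{R < ‖x‖}` (the components `hᵢⱼ` are smooth there, `AFEnd.contDiffAt_hCoeff`). [folklore] -/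
theorem continuousAt_fluxIntegrand (D : InitialDataSet (𝓡 3) X) (r : ℝ) {x : E3}
    (hx : e.R < ‖x‖) :
    ContinuousAt (fun x : E3 ↦ ∑ i : Fin 3, ∑ j : Fin 3,
      (partialH e D j i j x - partialH e D i j j x) * x i / r) x := by
  have hP : ∀ l i j : Fin 3, ContinuousAt (fun y : E3 ↦ partialH e D l i j y) x := by
    intro l i j
    have hg : ContDiffAt ℝ ∞ (fun y ↦ hCoeff e D y (EuclideanSpace.single i 1)
        (EuclideanSpace.single j 1)) x :=
      ((e.contDiffAt_hCoeff D hx).clm_apply contDiffAt_const).clm_apply contDiffAt_const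
    have h1 : ContDiffAt ℝ 0 (fun y ↦ fderiv ℝ (fun y ↦ hCoeff e D y (EuclideanSpace.single i 1)
        (EuclideanSpace.single j 1)) y (EuclideanSpace.single l 1)) x :=
      (hg.fderiv_right (m := 0) (by norm_num)).clm_apply contDiffAt_const
    exact h1.continuousAt
  have hxi : ∀ i : Fin 3, Continuous fun y : E3 ↦ y i := fun i ↦ by fun_prop
  refine tendsto_finsetSum _ fun i _ ↦ tendsto_finsetSum _ fun j _ ↦ ?_
  exact (((hP j i j).sub (hP i j j)).mul (hxi i).continuousAt).div_const r

/-- **The flux integrands of two data sets differ by at most `18 ‖D(h − h')(x)‖`** at every point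
`x` of the chart region on the sphere `‖x‖ = r`: the difference is `⟪x/‖x‖, admVecOf b (D(h − h')(x))⟫`
(`flux_integrand_eq`, `admVec_eq_admVecOf`, `admVecOf_sub`) and `‖admVecOf b τ‖ ≤ 2·3²·‖τ‖`
(`norm_admVecOf_le`). Bartnik 1986, (4.2), linearised. [cite: Bartnik1986, §4, (4.2)] -/
theorem abs_fluxIntegrand_sub_le (D D' : InitialDataSet (𝓡 3) X) {r : ℝ} {x : E3}
    (hxr : ‖x‖ = r) (hx : e.R < ‖x‖) :
    |(∑ i : Fin 3, ∑ j : Fin 3, (partialH e D j i j x - partialH e D i j j x) * x i / r) -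
        ∑ i : Fin 3, ∑ j : Fin 3, (partialH e D' j i j x - partialH e D' i j j x) * x i / r| ≤
      18 * ‖iteratedFDeriv ℝ 1 (fun y ↦ hCoeff e D y - hCoeff e D' y) x‖ := by
  classical
  set b := EuclideanSpace.basisFun (Fin 3) ℝ with hb
  set V : E3 → E3 := fun y ↦ ∑ i, (∑ j, (partialH e D j i j y - partialH e D i j j y)) • b i
    with hV
  set V' : E3 → E3 := fun y ↦ ∑ i, (∑ j, (partialH e D' j i j y - partialH e D' i j j y)) • b i
    with hV'
  rw [flux_integrand_eq e D V (fun _ ↦ rfl) hxr, flux_integrand_eq e D' V' (fun _ ↦ rfl) hxr,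
    ← inner_sub_right]
  have hdiff : DifferentiableAt ℝ (hCoeff e D) x :=
    (e.contDiffAt_hCoeff D hx).differentiableAt (by simp)
  have hdiff' : DifferentiableAt ℝ (hCoeff e D') x :=
    (e.contDiffAt_hCoeff D' hx).differentiableAt (by simp)
  have hVx : V x = admVecOf b (fderiv ℝ (hCoeff e D) x) :=
    admVec_eq_admVecOf b (e.admVec_repr D V fun _ ↦ rfl) hdiff
  have hV'x : V' x = admVecOf b (fderiv ℝ (hCoeff e D') x) :=
    admVec_eq_admVecOf b (e.admVec_repr D' V' fun _ ↦ rfl) hdiff'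
  rw [hVx, hV'x, ← admVecOf_sub, ← fderiv_fun_sub hdiff hdiff']
  have hunit : ‖(‖x‖⁻¹ : ℝ) • x‖ ≤ 1 := by
    by_cases hx0 : x = 0
    · simp [hx0]
    · exact (norm_smul_inv_norm hx0).le
  have hcard : 2 * (Fintype.card (Fin 3) : ℝ) ^ 2 = 18 := by norm_num
  calc |⟪(‖x‖⁻¹ : ℝ) • x,
        admVecOf b (fderiv ℝ (fun y ↦ hCoeff e D y - hCoeff e D' y) x)⟫|
      ≤ ‖(‖x‖⁻¹ : ℝ) • x‖ *
          ‖admVecOf b (fderiv ℝ (fun y ↦ hCoeff e D y - hCoeff e D' y) x)‖ :=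
        abs_real_inner_le_norm _ _
    _ ≤ 1 * (2 * (Fintype.card (Fin 3) : ℝ) ^ 2 *
          ‖fderiv ℝ (fun y ↦ hCoeff e D y - hCoeff e D' y) x‖) :=
        mul_le_mul hunit (norm_admVecOf_le b _) (norm_nonneg _) zero_le_one
    _ = 18 * ‖iteratedFDeriv ℝ 1 (fun y ↦ hCoeff e D y - hCoeff e D' y) x‖ := by
        rw [hcard, one_mul, norm_iteratedFDeriv_one]

/-! ### The flux bound -/

/-- **The ADM energy fluxes are Lipschitz in the weighted `C¹` seminorm**: if
`‖x‖² ‖D(h − h')(x)‖ ≤ W` on the chart region `{R < ‖x‖}`, then for every `r > R`,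
`|E_D(r) − E_{D'}(r)| ≤ (9/2) W` — pointwise the integrands differ by `≤ 18 W / r²`
(`abs_fluxIntegrand_sub_le`), the sphere has area `μHE[2](S_r) = 4πr²`
(`euclideanHausdorffMeasure_sphere_fin_three`), and `(16π)⁻¹ · 18 W r⁻² · 4πr² = 9W/2`; both
integrands are continuous on the compact sphere, hence integrable. Bartnik 1986, §4, (4.2) and
Prop. 4.1 (linear part). [cite: Bartnik1986, §4, (4.2), Prop. 4.1] -/
theorem abs_admEnergyFlux_sub_le (D D' : InitialDataSet (𝓡 3) X) {W : ℝ}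
    (hW : ∀ x : E3, e.R < ‖x‖ →
      ‖x‖ ^ 2 * ‖iteratedFDeriv ℝ 1 (fun y ↦ hCoeff e D y - hCoeff e D' y) x‖ ≤ W)
    {r : ℝ} (hr : e.R < r) :
    |e.admEnergyFlux D r - e.admEnergyFlux D' r| ≤ 9 / 2 * W := by
  have hr0 : 0 < r := e.R_pos.trans hr
  set μ : Measure E3 := μHE[2] with hμ
  set S : Set E3 := sphere 0 r with hS
  set f : InitialDataSet (𝓡 3) X → E3 → ℝ := fun D x ↦ ∑ i : Fin 3, ∑ j : Fin 3,
    (partialH e D j i j x - partialH e D i j j x) * x i / r with hf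
  have hflux : ∀ D'', e.admEnergyFlux D'' r = (16 * Real.pi)⁻¹ * ∫ x in S, f D'' x ∂μ :=
    fun _ ↦ rfl
  have hμS : μ S = ENNReal.ofReal (4 * Real.pi * r ^ 2) :=
    euclideanHausdorffMeasure_sphere_fin_three hr0
  have hμS' : μ S < ⊤ := by rw [hμS]; exact ENNReal.ofReal_lt_top
  have hμSr : μ.real S = 4 * Real.pi * r ^ 2 := by
    rw [measureReal_def, hμS, ENNReal.toReal_ofReal (by positivity)]
  have hSR : ∀ x ∈ S, e.R < ‖x‖ := fun x hx ↦ by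
    rw [hS, mem_sphere_zero_iff_norm] at hx
    rw [hx]; exact hr
  -- both integrands are continuous on the compact sphere, hence integrable
  have hcont : ∀ D'', ContinuousOn (f D'') S := fun D'' x hx ↦
    (e.continuousAt_fluxIntegrand D'' r (hSR x hx)).continuousWithinAt
  have hint : ∀ D'', IntegrableOn (f D'') S μ := by
    intro D''
    obtain ⟨C, hC⟩ := (isCompact_sphere (0 : E3) r).exists_bound_of_continuousOn (hcont D'')
    exact IntegrableOn.of_bound hμS'
      ((hcont D'').aestronglyMeasurable isClosed_sphere.measurableSet) C
      ((ae_restrict_iff' isClosed_sphere.measurableSet).2 (ae_of_all _ hC))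
  -- pointwise bound of the difference on the sphere
  have hW0 : 0 ≤ W := by
    obtain ⟨x, hx⟩ := (NormedSpace.sphere_nonempty (E := E3) (x := 0) (r := r)).2 hr0.le
    exact le_trans (by positivity) (hW x (hSR x hx))
  have hbd : ∀ x ∈ S, ‖f D x - f D' x‖ ≤ 18 * W / r ^ 2 := by
    intro x hx
    have hxr : ‖x‖ = r := mem_sphere_zero_iff_norm.1 hx
    have hxR : e.R < ‖x‖ := hSR x hx
    rw [Real.norm_eq_abs]
    calc |f D x - f D' x|
        ≤ 18 * ‖iteratedFDeriv ℝ 1 (fun y ↦ hCoeff e D y - hCoeff e D' y) x‖ :=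
          e.abs_fluxIntegrand_sub_le D D' hxr hxR
      _ ≤ 18 * (W / r ^ 2) := by
          gcongr
          rw [le_div_iff₀ (by positivity), mul_comm, ← hxr]
          exact hW x hxR
      _ = 18 * W / r ^ 2 := by ring
  -- the estimate
  have herr : ‖∫ x in S, (f D x - f D' x) ∂μ‖ ≤ 18 * W / r ^ 2 * μ.real S :=
    norm_setIntegral_le_of_norm_le_const hμS' hbd
  rw [hμSr, Real.norm_eq_abs] at herr
  rw [hflux D, hflux D', ← mul_sub, ← integral_sub (hint D) (hint D'), abs_mul,
    abs_of_pos (by positivity : (0 : ℝ) < (16 * Real.pi)⁻¹)]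
  calc (16 * Real.pi)⁻¹ * |∫ x in S, (f D x - f D' x) ∂μ|
      ≤ (16 * Real.pi)⁻¹ * (18 * W / r ^ 2 * (4 * Real.pi * r ^ 2)) :=
        mul_le_mul_of_nonneg_left herr (by positivity)
    _ = 9 / 2 * W := by
        field_simp
        ring

/-! ### From the weighted distance of the end -/

/-- The order-one term of the weighted distance: `e.wDist D D' ≤ W` (finite, `W ≥ 0`) gives
`‖x‖² ‖D(h − h')(x)‖ ≤ W` at every point of the chart region. Dafermos–Rodnianski 2013,
App. B.2.3 (the weight `r²` on first derivatives of `h`). [cite: DafermosRodnianski2013, App. B.2.3] -/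
theorem sq_mul_norm_iteratedFDeriv_one_le_of_wDist_le (D D' : InitialDataSet (𝓡 3) X) {W : ℝ}
    (hW0 : 0 ≤ W) (hd : e.wDist D D' ≤ ENNReal.ofReal W) {x : E3} (hx : e.R < ‖x‖) :
    ‖x‖ ^ 2 * ‖iteratedFDeriv ℝ 1 (fun y ↦ hCoeff e D y - hCoeff e D' y) x‖ ≤ W := by
  have h1 : ENNReal.ofReal (‖x‖ ^ (1 + 1)) *
      ‖iteratedFDeriv ℝ 1 (fun y ↦ hCoeff e D y - hCoeff e D' y) x‖ₑ ≤ e.wDist D D' := by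
    unfold wDist
    refine le_trans ?_ le_self_add
    exact le_iSup₂_of_le 1 (by norm_num) (le_iSup₂_of_le (f := fun (x : E3) (_ : e.R < ‖x‖) ↦
      ENNReal.ofReal (‖x‖ ^ (1 + 1)) *
        ‖iteratedFDeriv ℝ 1 (fun y ↦ hCoeff e D y - hCoeff e D' y) x‖ₑ) x hx le_rfl)
  have h2 := h1.trans hd
  rw [← ofReal_norm, ← ENNReal.ofReal_mul (by positivity),
    ENNReal.ofReal_le_ofReal_iff hW0] at h2
  have h11 : ‖x‖ ^ (1 + 1) = ‖x‖ ^ 2 := by norm_num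
  rwa [h11] at h2

/-- **Far fluxes are controlled by the weighted distance of the end**: if `e.wDist D D' ≤ W`
(`W ≥ 0` real) then `|E_D(r) − E_{D'}(r)| ≤ (9/2) W` for every `r > R`
(`abs_admEnergyFlux_sub_le` with the order-one term of `wDist`). Bartnik 1986, §4, (4.2),
Prop. 4.1 (linear part); Dafermos–Rodnianski 2013, App. B.2.3. [cite: Bartnik1986, §4, (4.2), Prop. 4.1] -/
theorem abs_admEnergyFlux_sub_le_of_wDist_le (D D' : InitialDataSet (𝓡 3) X) {W : ℝ}
    (hW0 : 0 ≤ W) (hd : e.wDist D D' ≤ ENNReal.ofReal W) {r : ℝ} (hr : e.R < r) :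
    |e.admEnergyFlux D r - e.admEnergyFlux D' r| ≤ 9 / 2 * W :=
  e.abs_admEnergyFlux_sub_le D D'
    (fun _ hx ↦ e.sq_mul_norm_iteratedFDeriv_one_le_of_wDist_le D D' hW0 hd hx) hr

end AFEnd

/-! ### Tame families: uniform control of all far fluxes -/

namespace InitialDataSet

variable {X : Type*} [TopologicalSpace X] [ChartedSpace E3 X] [IsManifold (𝓡 3) ∞ X]

/-- **Tame flux control** (`TameFluxControl`, first lemma of the crux-B idea card
`causal-quarantine`): along a tame family `F` on the end `e` the ADM energy fluxes through ALL
far coordinate spheres are uniformly close to those of the base datum — for every `η > 0` there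
is `ε > 0` with `|E_{F c}(r) − E_{F 0}(r)| ≤ η` for all `‖c‖ < ε` and all `r > R`. Only the
last clause of tameness (`e.wDist (F c) (F 0) → 0`) is used, through
`AFEnd.abs_admEnergyFlux_sub_le_of_wDist_le` with `W = 2η/9`. Quantitative "no screening":
no mass can be parked anywhere in the tail of a tame family. Christodoulou, CQG 16 (1999) A23,
p. A24 (the fixed space `𝓐`); Bartnik 1986, §4, (4.2). [cite: Christodoulou1999, p. A24] -/
theorem IsTameDataFamily.admEnergyFlux_uniform {e : AFEnd X} {m : ℕ}
    {F : EuclideanSpace ℝ (Fin m) → InitialDataSet (𝓡 3) X} (hF : IsTameDataFamily e m F)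
    {η : ℝ} (hη : 0 < η) :
    ∃ ε : ℝ, 0 < ε ∧ ∀ c : EuclideanSpace ℝ (Fin m), ‖c‖ < ε → ∀ r : ℝ, e.R < r →
      |e.admEnergyFlux (F c) r - e.admEnergyFlux (F 0) r| ≤ η := by
  obtain ⟨-, -, -, hlim⟩ := hF
  have hW : 0 < 2 / 9 * η := by positivity
  have hev : ∀ᶠ c in 𝓝 (0 : EuclideanSpace ℝ (Fin m)),
      e.wDist (F c) (F 0) < ENNReal.ofReal (2 / 9 * η) :=
    hlim (Iio_mem_nhds (ENNReal.ofReal_pos.2 hW))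
  obtain ⟨ε, hε, hball⟩ := Metric.eventually_nhds_iff.1 hev
  refine ⟨ε, hε, fun c hc r hr ↦ ?_⟩
  have hlt : e.wDist (F c) (F 0) < ENNReal.ofReal (2 / 9 * η) :=
    hball (by rwa [dist_zero_right])
  calc |e.admEnergyFlux (F c) r - e.admEnergyFlux (F 0) r| ≤ 9 / 2 * (2 / 9 * η) :=
        e.abs_admEnergyFlux_sub_le_of_wDist_le (F c) (F 0) hW.le hlt.le hr
    _ = η := by ring

end InitialDataSet

end Literature.Geometry.Lorentzian

end
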